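import Literature.Barriers.CriticalPhenomena.LaceExpansionIsingDeconvolutionConvAlgebra
import Literature.Barriers.CriticalPhenomena.LaceExpansionIsingDeconvolutionPartsEstimates
import Mathlib.Analysis.SpecificLimits.Normed
import HarnessLib

/-!
# Liu–Slade 2026, Proposition 4.1 (inhomogeneous deconvolution): proof of the named fact
# `LiuSlade2026_prop41`

Barrier catalogue `Literature/Barriers/CriticalPhenomena/` (D-0021), proofs companion of
`LaceExpansionIsingDeconvolutionParts.lean`. That file vendors Liu–Slade 2026, Proposition 4.1 —
the Banach-algebra reduction of the inhomogeneous convolution equation `H_z = h_z + zD*h_z*H_z`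
((4.1)) to the impulse equation `F_z * H_z = δ`, `F_z = δ - zD - Φ_z`, with
`|Φ_z(x)| ≤ O(β)δ_{0,x} + O(β₁)/⟦x⟧^{d+θ}` ((4.2)–(4.3)) — as the named fact
`SpreadOutIsing.LiuSlade2026_prop41`; here it is PROVED (`LiuSlade2026_prop41_holds`), following
the printed proof (§4 of the source) line by line, over the signed `ℓ¹` convolution algebra of
`LaceExpansionIsingDeconvolutionConvAlgebra.lean`:

* the Neumann series `v⁻¹ = Σ_{n ≥ 0} (δ - v)^{*n}` for `Σ|δ - v| < 1` ((4.5)): pointwise and `ℓ¹`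
  convergence, the deconvolution identity `v * v⁻¹ = δ` (telescoping after Fubini), the bound
  `Σ|v⁻¹ - δ| ≤ Σ|δ-v|/(1 - Σ|δ-v|)` ((4.6), `ℓ¹` part), and `ℤ^d`-symmetry;
* the refinement for `x ≠ 0` ((4.11)–(4.16)): with `f = δ - h`, `g_n = f^{*n} - f^{*n}(0)δ`,
  `g_{n+1}(x) = (g_n * f)(x) + f^{*n}(0) g_1(x)` (`x ≠ 0`), whence
  `‖g_n‖_ζ ≤ n‖f‖_ζ^{n-1}‖g_1‖_ζ` and `|x|^ζ |Σ_{n≥1} f^{*n}(x)| ≤ ‖g_1‖_ζ/(1 - ‖f‖_ζ)²`;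
* the assembly: `Φ = δ - h⁻¹`, `F = h⁻¹ - zD`, and for every bounded solution `H` of (4.1),
  `F * H = h⁻¹*H - zD*H = (h⁻¹*h) + z h⁻¹*(D*(h*H)) - zD*H = δ` ((4.7)–(4.8)), the rearrangement
  `h⁻¹*(D*(h*H)) = D*((h⁻¹*h)*H)` being associativity/commutativity of absolutely convergent
  convolutions (`h⁻¹, h, D ∈ ℓ¹`, `H` bounded). Constants: with `ζ = d + θ`,
  `K₁ = Σ_x ⟦x⟧^{-ζ}`, `K = 2^{ζ+1}(1 + K₁)`: `‖f‖_ζ ≤ βK`, `‖g_1‖_ζ ≤ β₁K`, `β⋆ = 1/(2K)`,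
  `C = 4K`.

## References

* Y. Liu, G. Slade, *Gaussian deconvolution and the lace expansion for spread-out models*,
  Ann. Inst. H. Poincaré Probab. Statist. (2026), arXiv:2310.07640: §4, Proposition 4.1 with
  (4.1)–(4.3), the norm (4.4), the Neumann series (4.5)–(4.6), and the proof (4.7)–(4.16)
  [LiuSlade2026]. Equation numbers are those of the arXiv version held in the literature store.
-/

noncomputable section

namespace Literature.Barriers.CriticalPhenomena.SpreadOutIsing

open Filter Literature.Probability.LatticeModels
open _root_.Topology

variable {d : ℕ}

/-! ## Part 1. The Neumann series `Σ_n f^{*n}` and the deconvolution `(δ - f)⁻¹` -/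

section Neumann

variable {f g : Site d → ℝ}

/-- Linearity in the left slot without scalar: `(f₁ - f₂) * g = f₁ * g - f₂ * g` at `x`.
[folklore] -/
theorem latticeConv_sub_left {f₁ f₂ : Site d → ℝ} (g : Site d → ℝ) {x : Site d}
    (h₁ : Summable fun y => f₁ y * g (x - y)) (h₂ : Summable fun y => f₂ y * g (x - y)) :
    latticeConv (fun y => f₁ y - f₂ y) g x = latticeConv f₁ g x - latticeConv f₂ g x := by
  have h := latticeConv_sub_smul_left (g := g) 1 h₁ h₂
  simp only [one_mul] at h
  exact h

/-- The Neumann series converges absolutely at every point when `Σ|f| < 1`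
(`|f^{*n}(x)| ≤ (Σ|f|)^n`). [cite: LiuSlade2026, §4 ((4.5): "a convergent Neumann series")] -/
theorem summable_abs_convPow_apply (hf : Summable fun x => |f x|) (hlt : ∑' x, |f x| < 1)
    (x : Site d) : Summable fun n => |convPow f n x| :=
  Summable.of_nonneg_of_le (fun _ => abs_nonneg _) (fun n => abs_convPow_le hf n x)
    (summable_geometric_of_lt_one (tsum_nonneg fun _ => abs_nonneg _) hlt)

/-- The Neumann series converges at every point when `Σ|f| < 1`. [cite: LiuSlade2026, §4 (4.5)] -/
theorem summable_convPow_apply (hf : Summable fun x => |f x|) (hlt : ∑' x, |f x| < 1)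
    (x : Site d) : Summable fun n => convPow f n x :=
  (summable_abs_convPow_apply hf hlt x).of_abs

/-- The Neumann series without its `n = 0` term: `Σ_n f^{*n}(x) = δ(x) + Σ_n f^{*(n+1)}(x)`.
[cite: LiuSlade2026, §4 (4.5)] -/
theorem tsum_convPow_eq_delta0_add (hf : Summable fun x => |f x|) (hlt : ∑' x, |f x| < 1)
    (x : Site d) : ∑' n, convPow f n x = delta0 x + ∑' n, convPow f (n + 1) x := by
  rw [(summable_convPow_apply hf hlt x).tsum_eq_zero_add]
  rfl

/-- The tail of the Neumann series is bounded pointwise: `|Σ_n f^{*(n+1)}(x)| ≤ ρ/(1-ρ)`,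
`ρ = Σ|f| < 1`. [cite: LiuSlade2026, §4 (4.6)] -/
theorem abs_tsum_convPow_succ_le (hf : Summable fun x => |f x|) (hlt : ∑' x, |f x| < 1)
    (x : Site d) :
    |∑' n, convPow f (n + 1) x| ≤ (∑' x, |f x|) / (1 - ∑' x, |f x|) := by
  set ρ := ∑' x, |f x| with hρ
  have h0 : 0 ≤ ρ := tsum_nonneg fun _ => abs_nonneg _
  have hs : Summable fun n => |convPow f (n + 1) x| :=
    (summable_nat_add_iff 1).2 (summable_abs_convPow_apply hf hlt x)
  have hgeo : HasSum (fun n : ℕ => ρ ^ (n + 1)) (ρ / (1 - ρ)) := by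
    have h := (hasSum_geometric_of_lt_one h0 hlt).mul_left ρ
    simp only [← pow_succ'] at h
    rwa [div_eq_mul_inv]
  calc |∑' n, convPow f (n + 1) x| ≤ ∑' n, |convPow f (n + 1) x| := abs_tsum_le_tsum_abs hs
    _ ≤ ρ / (1 - ρ) := hasSum_le (fun n => abs_convPow_le hf (n + 1) x) hs.hasSum hgeo

/-- The Neumann series is bounded pointwise: `|Σ_n f^{*n}(x)| ≤ 1/(1-ρ)`, `ρ = Σ|f| < 1`.
[cite: LiuSlade2026, §4 (4.5)] -/
theorem abs_tsum_convPow_le (hf : Summable fun x => |f x|) (hlt : ∑' x, |f x| < 1)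
    (x : Site d) : |∑' n, convPow f n x| ≤ (1 - ∑' x, |f x|)⁻¹ := by
  set ρ := ∑' x, |f x| with hρ
  have h0 : 0 ≤ ρ := tsum_nonneg fun _ => abs_nonneg _
  have hs := summable_abs_convPow_apply hf hlt x
  calc |∑' n, convPow f n x| ≤ ∑' n, |convPow f n x| := abs_tsum_le_tsum_abs hs
    _ ≤ (1 - ρ)⁻¹ := hasSum_le (fun n => abs_convPow_le hf n x) hs.hasSum
        (hasSum_geometric_of_lt_one h0 hlt)

/-- **`ℓ¹` convergence of the Neumann series** (the `ℓ¹` part of (4.6),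
`‖v⁻¹ - δ‖ ≤ ‖v - δ‖/(1 - ‖v - δ‖)`): the tail `Σ_n f^{*(n+1)}` is absolutely summable over
`ℤ^d` with `Σ_x |Σ_n f^{*(n+1)}(x)| ≤ ρ/(1-ρ)` (Fubini for the non-negative family
`|f^{*(n+1)}(x)|` on `ℕ × ℤ^d`, `Σ_x |f^{*(n+1)}(x)| ≤ ρ^{n+1}`). [cite: LiuSlade2026, §4 (4.6)] -/
theorem summable_abs_tsum_convPow_succ (hf : Summable fun x => |f x|) (hlt : ∑' x, |f x| < 1) :
    (Summable fun x => |∑' n, convPow f (n + 1) x|) ∧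
      ∑' x, |∑' n, convPow f (n + 1) x| ≤ (∑' x, |f x|) / (1 - ∑' x, |f x|) := by
  set ρ := ∑' x, |f x| with hρ
  have h0 : 0 ≤ ρ := tsum_nonneg fun _ => abs_nonneg _
  -- the non-negative family `G n x = |f^{*(n+1)}(x)|` on `ℕ × ℤ^d`
  set G : ℕ → Site d → ℝ := fun n x => |convPow f (n + 1) x| with hG
  have hGn : ∀ n, Summable fun x => G n x := fun n => (tsum_abs_convPow_le hf (n + 1)).1
  have hGsum : ∀ n, ∑' x, G n x ≤ ρ ^ (n + 1) := fun n => (tsum_abs_convPow_le hf (n + 1)).2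
  have hgeo : HasSum (fun n : ℕ => ρ ^ (n + 1)) (ρ / (1 - ρ)) := by
    have h := (hasSum_geometric_of_lt_one h0 hlt).mul_left ρ
    simp only [← pow_succ'] at h
    rwa [div_eq_mul_inv]
  have hGF : Summable (Function.uncurry G) := by
    refine (summable_prod_of_nonneg fun p => abs_nonneg _).2 ⟨hGn, ?_⟩
    exact Summable.of_nonneg_of_le (fun n => tsum_nonneg fun _ => abs_nonneg _) hGsum hgeo.summable
  have hx : ∀ x, Summable fun n => G n x := fun x => hGF.prod_symm.prod_factor x
  have hsum_x : Summable fun x => ∑' n, G n x := hGF.prod_symm.prod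
  have hle : ∀ x, |∑' n, convPow f (n + 1) x| ≤ ∑' n, G n x := fun x =>
    abs_tsum_le_tsum_abs (hx x)
  have hsumm : Summable fun x => |∑' n, convPow f (n + 1) x| :=
    Summable.of_nonneg_of_le (fun _ => abs_nonneg _) hle hsum_x
  refine ⟨hsumm, ?_⟩
  calc ∑' x, |∑' n, convPow f (n + 1) x| ≤ ∑' x, ∑' n, G n x := hsumm.tsum_le_tsum hle hsum_x
    _ = ∑' n, ∑' x, G n x := hGF.tsum_comm
    _ ≤ ρ / (1 - ρ) := hasSum_le hGsum hGF.prod.hasSum hgeo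

/-- The full Neumann series `Σ_n f^{*n} = δ + Σ_n f^{*(n+1)}` is absolutely summable over `ℤ^d`.
[cite: LiuSlade2026, §4 (4.5)–(4.6)] -/
theorem summable_abs_tsum_convPow (hf : Summable fun x => |f x|) (hlt : ∑' x, |f x| < 1) :
    Summable fun x => |∑' n, convPow f n x| := by
  have h := (summable_abs_delta0 (d := d)).add (summable_abs_tsum_convPow_succ hf hlt).1
  refine Summable.of_nonneg_of_le (fun _ => abs_nonneg _) (fun x => ?_) h
  rw [tsum_convPow_eq_delta0_add hf hlt x]
  exact abs_add_le _ _

/-- **The deconvolution identity** `v * v⁻¹ = δ` for `v = δ - f`, `v⁻¹ = Σ_n f^{*n}`, `Σ|f| < 1`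
("by writing `v = δ - (δ - v)`, we have
`v*v⁻¹ = Σ_{n≥0}(δ-v)^{*n} - Σ_{n≥1}(δ-v)^{*n} = δ`"; Fubini for the absolutely summable family
`f(y) f^{*n}(x-y)` on `ℤ^d × ℕ`). [cite: LiuSlade2026, §4 (4.5)] -/
theorem latticeConv_delta0_sub_neumann (hf : Summable fun x => |f x|) (hlt : ∑' x, |f x| < 1)
    (x : Site d) :
    latticeConv (fun y => delta0 y - f y) (fun y => ∑' n, convPow f n y) x = delta0 x := by
  set ρ := ∑' x, |f x| with hρ
  have h0 : 0 ≤ ρ := tsum_nonneg fun _ => abs_nonneg _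
  set inv : Site d → ℝ := fun y => ∑' n, convPow f n y with hinv
  have hbd : ∀ y, |inv y| ≤ (1 - ρ)⁻¹ := fun y => abs_tsum_convPow_le hf hlt y
  have hδ : Summable fun y => delta0 y * inv (x - y) :=
    summable_latticeConv_term_of_bdd summable_abs_delta0 hbd x
  have hfi : Summable fun y => f y * inv (x - y) := summable_latticeConv_term_of_bdd hf hbd x
  rw [latticeConv_sub_left inv hδ hfi, latticeConv_delta0_left]
  -- `f * inv = Σ_n f^{*(n+1)}`
  have hfam : Summable (Function.uncurry fun y n => f y * convPow f n (x - y)) := by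
    have hb : Summable fun p : Site d × ℕ => |f p.1| * ρ ^ p.2 := by
      refine summable_mul_of_summable_norm (f := fun y => |f y|) (g := fun n => ρ ^ n) ?_ ?_
      · simpa only [Real.norm_eq_abs, abs_abs] using hf
      · simpa only [Real.norm_eq_abs, abs_of_nonneg (pow_nonneg h0 _)] using
          (summable_geometric_of_lt_one h0 hlt)
    refine Summable.of_norm_bounded hb fun p => ?_
    obtain ⟨y, n⟩ := p
    rw [Function.uncurry_apply_pair, Real.norm_eq_abs, abs_mul]
    exact mul_le_mul_of_nonneg_left (abs_convPow_le hf n _) (abs_nonneg _)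
  have hfinv : latticeConv f inv x = ∑' n, convPow f (n + 1) x := by
    calc latticeConv f inv x = ∑' y, ∑' n, f y * convPow f n (x - y) :=
          tsum_congr fun y => tsum_mul_left.symm
      _ = ∑' n, ∑' y, f y * convPow f n (x - y) := hfam.tsum_comm.symm
      _ = ∑' n, latticeConv f (convPow f n) x := rfl
      _ = ∑' n, convPow f (n + 1) x :=
          tsum_congr fun n => by rw [convPow_succ, latticeConv_comm]
  rw [hfinv, show inv x = delta0 x + ∑' n, convPow f (n + 1) x from
    tsum_convPow_eq_delta0_add hf hlt x]
  ring

/-- The Neumann series of a `ℤ^d`-symmetric function is `ℤ^d`-symmetric. [folklore] -/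
theorem isZdSymmetric_tsum_convPow (hfs : IsZdSymmetric f) :
    IsZdSymmetric fun y => ∑' n, convPow f n y := fun π ε x =>
  tsum_congr fun n => isZdSymmetric_convPow hfs n π ε x

/-! ### The refinement for `x ≠ 0` ((4.11)–(4.16)) -/

/-- `f` minus its value at the origin, `g_1 = f - f(0)δ`, is absolutely summable with `f`.
[cite: LiuSlade2026, §4 (g_n = f^{*n} - f^{*n}(0)δ)] -/
theorem summable_abs_sub_apply_zero_mul_delta0 (hf : Summable fun x => |f x|) :
    Summable fun x => |f x - f 0 * delta0 x| := by
  refine Summable.of_nonneg_of_le (fun _ => abs_nonneg _) (fun x => ?_)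
    (hf.add ((summable_abs_delta0 (d := d)).mul_left |f 0|))
  calc |f x - f 0 * delta0 x| ≤ |f x| + |f 0 * delta0 x| := abs_sub _ _
    _ = |f x| + |f 0| * |delta0 x| := by rw [abs_mul]

/-- **The recursion (4.12)–(4.13) in norm form.** With `g_n = f^{*n} - f^{*n}(0)δ`: for every
`y`, `|g_{n+2}(y)| ≤ |(g_{n+1} * f)(y)| + |f^{*(n+1)}(0)| |g_1(y)|` (both sides vanish at
`y = 0`; off the origin `g_{n+2} = f^{*(n+1)} * f = g_{n+1} * f + f^{*(n+1)}(0) f` and `f = g_1`).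
[cite: LiuSlade2026, §4 (4.12)–(4.13)] -/
theorem abs_convPow_sub_le (hf : Summable fun x => |f x|) (n : ℕ) (y : Site d) :
    |convPow f (n + 2) y - convPow f (n + 2) 0 * delta0 y| ≤
      |latticeConv (fun u => convPow f (n + 1) u - convPow f (n + 1) 0 * delta0 u) f y| +
        |convPow f (n + 1) 0| * |f y - f 0 * delta0 y| := by
  by_cases hy : y = 0
  · subst hy
    rw [delta0_zero, mul_one, sub_self, abs_zero]
    positivity
  · rw [delta0_of_ne_zero hy, mul_zero, sub_zero, mul_zero, sub_zero]
    -- `f^{*(n+2)}(y) = (g_{n+1} * f)(y) + f^{*(n+1)}(0) f(y)`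
    have hfb : ∀ u, |f u| ≤ ∑' x, |f x| := abs_le_tsum_abs hf
    have hgs : Summable fun u => |convPow f (n + 1) u - convPow f (n + 1) 0 * delta0 u| :=
      summable_abs_sub_apply_zero_mul_delta0 (tsum_abs_convPow_le hf (n + 1)).1
    have h1 : Summable fun u =>
        (convPow f (n + 1) u - convPow f (n + 1) 0 * delta0 u) * f (y - u) :=
      summable_latticeConv_term_of_bdd hgs hfb y
    have h2 : Summable fun u => delta0 u * f (y - u) :=
      summable_latticeConv_term_of_bdd summable_abs_delta0 hfb y
    have heq : convPow f (n + 2) y =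
        latticeConv (fun u => convPow f (n + 1) u - convPow f (n + 1) 0 * delta0 u) f y +
          convPow f (n + 1) 0 * f y := by
      have hsplit : convPow f (n + 1) = fun u =>
          (convPow f (n + 1) u - convPow f (n + 1) 0 * delta0 u) +
            convPow f (n + 1) 0 * delta0 u := funext fun u => by ring
      calc convPow f (n + 2) y = latticeConv (convPow f (n + 1)) f y := rfl
        _ = latticeConv (fun u => (convPow f (n + 1) u - convPow f (n + 1) 0 * delta0 u) +
              convPow f (n + 1) 0 * delta0 u) f y := congrArg (fun g => latticeConv g f y) hsplit
        _ = latticeConv (fun u => convPow f (n + 1) u - convPow f (n + 1) 0 * delta0 u) f y +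
              convPow f (n + 1) 0 * latticeConv delta0 f y := latticeConv_add_smul_left _ h1 h2
        _ = _ := by rw [latticeConv_delta0_left]
    rw [heq]
    calc _ ≤ |latticeConv (fun u => convPow f (n + 1) u - convPow f (n + 1) 0 * delta0 u) f y| +
          |convPow f (n + 1) 0 * f y| := abs_add_le _ _
      _ = _ := by rw [abs_mul]

/-- **(4.14)–(4.15)**: `‖g_{n+1}‖_ζ ≤ (n+1)‖f‖_ζ^n ‖g_1‖_ζ`, unbundled (`M` a bound for `‖f‖_ζ`,
`M₁` for `‖g_1‖_ζ`; `Σ|f| ≤ M` is part of `‖f‖_ζ ≤ M` as `2^{ζ+1} ≥ 1`).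
[cite: LiuSlade2026, §4 (4.14)–(4.15)] -/
theorem lsNorm_convPow_sub_le {ζ M M₁ : ℝ} (hζ : 0 ≤ ζ) (hf : Summable fun x => |f x|)
    (hf1 : 2 ^ (ζ + 1) * ∑' x, |f x| ≤ M) (hf2 : ∀ x, euclidNorm x ^ ζ * |f x| ≤ M)
    (hg1 : 2 ^ (ζ + 1) * ∑' x, |f x - f 0 * delta0 x| ≤ M₁)
    (hg2 : ∀ x, euclidNorm x ^ ζ * |f x - f 0 * delta0 x| ≤ M₁) (n : ℕ) :
    (Summable fun x => |convPow f (n + 1) x - convPow f (n + 1) 0 * delta0 x|) ∧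
      2 ^ (ζ + 1) * ∑' x, |convPow f (n + 1) x - convPow f (n + 1) 0 * delta0 x| ≤
        (n + 1) * M ^ n * M₁ ∧
      ∀ x, euclidNorm x ^ ζ * |convPow f (n + 1) x - convPow f (n + 1) 0 * delta0 x| ≤
        (n + 1) * M ^ n * M₁ := by
  have hM0 : 0 ≤ M := le_trans (mul_nonneg (Real.rpow_nonneg (euclidNorm_nonneg _) _)
    (abs_nonneg _)) (hf2 0)
  have hM₁0 : 0 ≤ M₁ := le_trans (mul_nonneg (Real.rpow_nonneg (euclidNorm_nonneg _) _)
    (abs_nonneg _)) (hg2 0)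
  have h2pos : (0 : ℝ) < 2 ^ (ζ + 1) := by positivity
  have h2one : (1 : ℝ) ≤ 2 ^ (ζ + 1) := Real.one_le_rpow (by norm_num) (by linarith)
  -- `Σ|f| ≤ M`, hence `|f^{*m}(0)| ≤ M^m`
  have hρM : ∑' x, |f x| ≤ M := by
    have h : ∑' x, |f x| ≤ 2 ^ (ζ + 1) * ∑' x, |f x| :=
      le_mul_of_one_le_left (tsum_nonneg fun _ => abs_nonneg _) h2one
    exact h.trans hf1
  have hc : ∀ m, |convPow f m 0| ≤ M ^ m := fun m =>
    (abs_convPow_le hf m 0).trans (pow_le_pow_left₀ (tsum_nonneg fun _ => abs_nonneg _) hρM m)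
  induction n with
  | zero =>
    simp only [zero_add, convPow_one_eq, Nat.cast_zero, pow_zero, mul_one, one_mul]
    exact ⟨summable_abs_sub_apply_zero_mul_delta0 hf, hg1, hg2⟩
  | succ n ih =>
    obtain ⟨hs, hA, hB⟩ := ih
    -- the product bound for `g_{n+1} * f`
    obtain ⟨hcs, hcA, hcB⟩ := lsNorm_latticeConv_le hζ hs hf hA hB hf1 hf2
    set gn : Site d → ℝ := fun u => convPow f (n + 1) u - convPow f (n + 1) 0 * delta0 u with hgn
    set g₁ : Site d → ℝ := fun u => f u - f 0 * delta0 u with hg₁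
    have hg₁s : Summable fun x => |g₁ x| := summable_abs_sub_apply_zero_mul_delta0 hf
    have hpt : ∀ y, |convPow f (n + 2) y - convPow f (n + 2) 0 * delta0 y| ≤
        |latticeConv gn f y| + |convPow f (n + 1) 0| * |g₁ y| := abs_convPow_sub_le hf n
    have hdom : Summable fun y => |latticeConv gn f y| + |convPow f (n + 1) 0| * |g₁ y| :=
      hcs.add (hg₁s.mul_left _)
    have hs' : Summable fun x => |convPow f (n + 2) x - convPow f (n + 2) 0 * delta0 x| :=
      Summable.of_nonneg_of_le (fun _ => abs_nonneg _) hpt hdom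
    have hpow : ((n : ℝ) + 1) * M ^ n * M₁ * M + M ^ (n + 1) * M₁ =
        ((n + 1 : ℕ) + 1) * M ^ (n + 1) * M₁ := by push_cast; ring
    have hg1' : 2 ^ (ζ + 1) * ∑' y, |g₁ y| ≤ M₁ := hg1
    have hg2' : ∀ y, euclidNorm y ^ ζ * |g₁ y| ≤ M₁ := hg2
    refine ⟨hs', ?_, fun x => ?_⟩
    · calc 2 ^ (ζ + 1) * ∑' x, |convPow f (n + 1 + 1) x - convPow f (n + 1 + 1) 0 * delta0 x|
          ≤ 2 ^ (ζ + 1) * ∑' y, (|latticeConv gn f y| + |convPow f (n + 1) 0| * |g₁ y|) :=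
            mul_le_mul_of_nonneg_left (hs'.tsum_le_tsum hpt hdom) h2pos.le
        _ = 2 ^ (ζ + 1) * ∑' y, |latticeConv gn f y| +
              |convPow f (n + 1) 0| * (2 ^ (ζ + 1) * ∑' y, |g₁ y|) := by
            rw [hcs.tsum_add (hg₁s.mul_left _), tsum_mul_left]; ring
        _ ≤ (n + 1) * M ^ n * M₁ * M + M ^ (n + 1) * M₁ :=
            add_le_add hcA (mul_le_mul (hc (n + 1)) hg1'
              (mul_nonneg h2pos.le (tsum_nonneg fun _ => abs_nonneg _)) (pow_nonneg hM0 _))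
        _ = _ := hpow
    · calc euclidNorm x ^ ζ * |convPow f (n + 1 + 1) x - convPow f (n + 1 + 1) 0 * delta0 x|
          ≤ euclidNorm x ^ ζ * (|latticeConv gn f x| + |convPow f (n + 1) 0| * |g₁ x|) :=
            mul_le_mul_of_nonneg_left (hpt x) (Real.rpow_nonneg (euclidNorm_nonneg _) _)
        _ = euclidNorm x ^ ζ * |latticeConv gn f x| +
              |convPow f (n + 1) 0| * (euclidNorm x ^ ζ * |g₁ x|) := by ring
        _ ≤ (n + 1) * M ^ n * M₁ * M + M ^ (n + 1) * M₁ :=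
            add_le_add (hcB x) (mul_le_mul (hc (n + 1)) (hg2' x)
              (mul_nonneg (Real.rpow_nonneg (euclidNorm_nonneg _) _) (abs_nonneg _))
              (pow_nonneg hM0 _))
        _ = _ := hpow

/-- `Σ_n (n+1) Mⁿ = 1/(1-M)²` for `0 ≤ M < 1`. [folklore] -/
theorem hasSum_coe_add_one_mul_pow {M : ℝ} (hM0 : 0 ≤ M) (hM1 : M < 1) :
    HasSum (fun n : ℕ => ((n : ℝ) + 1) * M ^ n) (1 / (1 - M) ^ 2) := by
  have hnorm : ‖M‖ < 1 := by rwa [Real.norm_eq_abs, abs_of_nonneg hM0]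
  have h1 := hasSum_coe_mul_geometric_of_norm_lt_one hnorm
  have h2 := hasSum_geometric_of_lt_one hM0 hM1
  have h := h1.add h2
  have hne : (1 - M) ≠ 0 := by linarith
  have hfun : (fun n : ℕ => ((n : ℝ) + 1) * M ^ n) = fun n : ℕ => (n : ℝ) * M ^ n + M ^ n :=
    funext fun n => by ring
  have hval : 1 / (1 - M) ^ 2 = M / (1 - M) ^ 2 + (1 - M)⁻¹ := by
    field_simp
    ring
  rw [hfun, hval]
  exact h

/-- **(4.16)**: for `x ≠ 0`, `|x|^ζ |Σ_{n≥1} f^{*n}(x)| ≤ ‖g_1‖_ζ/(1 - ‖f‖_ζ)²`, unbundled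
(`‖f‖_ζ ≤ M < 1`, `‖g_1‖_ζ ≤ M₁`; off the origin `f^{*n} = g_n` and
`Σ_n ‖g_n‖_ζ ≤ Σ_n n M^{n-1} M₁`). [cite: LiuSlade2026, §4 (4.11) and (4.16)] -/
theorem rpow_mul_abs_tsum_convPow_succ_le {ζ M M₁ : ℝ} (hζ : 0 ≤ ζ)
    (hf : Summable fun x => |f x|) (hf1 : 2 ^ (ζ + 1) * ∑' x, |f x| ≤ M)
    (hf2 : ∀ x, euclidNorm x ^ ζ * |f x| ≤ M) (hM : M < 1)
    (hg1 : 2 ^ (ζ + 1) * ∑' x, |f x - f 0 * delta0 x| ≤ M₁)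
    (hg2 : ∀ x, euclidNorm x ^ ζ * |f x - f 0 * delta0 x| ≤ M₁) {x : Site d} (hx : x ≠ 0) :
    euclidNorm x ^ ζ * |∑' n, convPow f (n + 1) x| ≤ M₁ / (1 - M) ^ 2 := by
  have hM0 : 0 ≤ M := le_trans (mul_nonneg (Real.rpow_nonneg (euclidNorm_nonneg _) _)
    (abs_nonneg _)) (hf2 0)
  have h2one : (1 : ℝ) ≤ 2 ^ (ζ + 1) := Real.one_le_rpow (by norm_num) (by linarith)
  have hρM : ∑' x, |f x| ≤ M := by
    have h : ∑' x, |f x| ≤ 2 ^ (ζ + 1) * ∑' x, |f x| :=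
      le_mul_of_one_le_left (tsum_nonneg fun _ => abs_nonneg _) h2one
    exact h.trans hf1
  have hlt : ∑' x, |f x| < 1 := lt_of_le_of_lt hρM hM
  have hs : Summable fun n => |convPow f (n + 1) x| :=
    (summable_nat_add_iff 1).2 (summable_abs_convPow_apply hf hlt x)
  have hxpow : 0 ≤ euclidNorm x ^ ζ := Real.rpow_nonneg (euclidNorm_nonneg _) _
  -- off the origin `f^{*(n+1)}(x) = g_{n+1}(x)`
  have hgx : ∀ n, convPow f (n + 1) x = convPow f (n + 1) x - convPow f (n + 1) 0 * delta0 x :=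
    fun n => by rw [delta0_of_ne_zero hx, mul_zero, sub_zero]
  have hterm : ∀ n, euclidNorm x ^ ζ * |convPow f (n + 1) x| ≤ ((n : ℝ) + 1) * M ^ n * M₁ :=
    fun n => by
      rw [hgx n]
      exact (lsNorm_convPow_sub_le hζ hf hf1 hf2 hg1 hg2 n).2.2 x
  calc euclidNorm x ^ ζ * |∑' n, convPow f (n + 1) x|
      ≤ euclidNorm x ^ ζ * ∑' n, |convPow f (n + 1) x| :=
        mul_le_mul_of_nonneg_left (abs_tsum_le_tsum_abs hs) hxpow
    _ = ∑' n, euclidNorm x ^ ζ * |convPow f (n + 1) x| := tsum_mul_left.symm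
    _ ≤ ∑' n : ℕ, ((n : ℝ) + 1) * M ^ n * M₁ :=
        (hs.mul_left _).tsum_le_tsum hterm ((hasSum_coe_add_one_mul_pow hM0 hM).mul_right M₁).summable
    _ = 1 / (1 - M) ^ 2 * M₁ := ((hasSum_coe_add_one_mul_pow hM0 hM).mul_right M₁).tsum_eq
    _ = M₁ / (1 - M) ^ 2 := by ring

end Neumann

/-! ## Part 2. Proposition 4.1 -/

section Prop41

variable {L : ℕ}

/-- **The algebra of (4.7)–(4.8)**: if `a * h = δ` with `a, h ∈ ℓ¹` (here `a = h⁻¹`), `D ∈ ℓ¹`,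
and `H` is a bounded solution of `H = h + zD*(h*H)`, then `(a - zD) * H = δ`
(`(a - zD)*H = a*h + z a*(D*(h*H)) - zD*H` and `a*(D*(h*H)) = D*((a*h)*H) = D*H` by
associativity and commutativity of the absolutely convergent convolutions).
[cite: LiuSlade2026, §4 (4.7)–(4.8)] -/
theorem latticeConv_inv_sub_smul_eq_delta0 {a h D H : Site d → ℝ} {z M : ℝ}
    (ha : Summable fun x => |a x|) (hh : Summable fun x => |h x|) (hD : Summable fun x => |D x|)
    (hHM : ∀ x, |H x| ≤ M) (hah : ∀ x, latticeConv a h x = delta0 x)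
    (hH : ∀ x, H x = h x + z * latticeConv D (latticeConv h H) x) (x : Site d) :
    latticeConv (fun y => a y - z * D y) H x = delta0 x := by
  -- bounds: `h`, `h*H`, `D*(h*H)` are bounded
  have hhb : ∀ y, |h y| ≤ ∑' u, |h u| := abs_le_tsum_abs hh
  have hhH : ∀ y, |latticeConv h H y| ≤ (∑' u, |h u|) * M := abs_latticeConv_le_of_bdd hh hHM
  set Kf : Site d → ℝ := latticeConv D (latticeConv h H) with hKf
  have hKfb : ∀ y, |Kf y| ≤ (∑' u, |D u|) * ((∑' u, |h u|) * M) :=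
    abs_latticeConv_le_of_bdd hD hhH
  -- (i) `(a - zD) * H = a*H - z D*H`
  have h1 : latticeConv (fun y => a y - z * D y) H x =
      latticeConv a H x - z * latticeConv D H x :=
    latticeConv_sub_smul_left z (summable_latticeConv_term_of_bdd ha hHM x)
      (summable_latticeConv_term_of_bdd hD hHM x)
  -- (ii) `a * H = a * h + z a * Kf`
  have h2 : latticeConv a H x = latticeConv a h x + z * latticeConv a Kf x := by
    have hHfun : H = fun y => h y + z * Kf y := funext hH
    conv_lhs => rw [hHfun]
    exact latticeConv_add_smul_right z (summable_latticeConv_term_of_bdd ha hhb x)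
      (summable_latticeConv_term_of_bdd ha hKfb x)
  -- (iii) `a * Kf = D * H`
  have hahfun : latticeConv a h = delta0 := funext hah
  have h3 : latticeConv a Kf x = latticeConv D H x := by
    calc latticeConv a (latticeConv D (latticeConv h H)) x
        = latticeConv (latticeConv a D) (latticeConv h H) x :=
          (latticeConv_assoc_of_bdd ha hD hhH x).symm
      _ = latticeConv (latticeConv D a) (latticeConv h H) x := by
          rw [show latticeConv a D = latticeConv D a from funext fun y => latticeConv_comm a D y]
      _ = latticeConv D (latticeConv a (latticeConv h H)) x := latticeConv_assoc_of_bdd hD ha hhH x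
      _ = latticeConv D (latticeConv (latticeConv a h) H) x := by
          rw [show latticeConv a (latticeConv h H) = latticeConv (latticeConv a h) H from
            funext fun y => (latticeConv_assoc_of_bdd ha hh hHM y).symm]
      _ = latticeConv D H x := by
          rw [hahfun, show latticeConv delta0 H = H from funext fun y => latticeConv_delta0_left H y]
  rw [h1, h2, hah, h3]
  ring

/-- **Liu–Slade 2026, Proposition 4.1** — discharge of the named fact `LiuSlade2026_prop41` by the
printed Banach-algebra proof: `Φ = δ - h⁻¹` with `h⁻¹ = Σ_n (δ - h)^{*n}` the Neumann series in
`(ℓ¹(ℤ^d), *)` (convergent since `‖δ - h‖_ζ = O(β) < 1`, `ζ = d + θ`), `F = δ - zD - Φ = h⁻¹ - zD`,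
`F * H = h⁻¹*(H - zD*h*H) = h⁻¹*h = δ` for every bounded solution of `H = h + zD*h*H`, and
`|Φ(x)| ≤ O(β)δ_{0,x} + O(β₁)/⟦x⟧^{d+θ}` from `‖h⁻¹ - δ‖_ζ ≤ ‖h-δ‖_ζ/(1-‖h-δ‖_ζ)` at `x = 0` and
the `g_n`-recursion off the origin. Constants: `β⋆ = 1/(2K)`, `C = 4K`,
`K = 2^{ζ+1}(1 + Σ_x⟦x⟧^{-ζ})`. [cite: LiuSlade2026, Proposition 4.1 with (4.1)–(4.3) and its proof (4.4)–(4.16)] -/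
theorem LiuSlade2026_prop41_holds : LiuSlade2026_prop41 := by
  intro d _hd θ hθ
  -- constants depending on `d, θ` only
  set ζ : ℝ := (d : ℝ) + θ with hζdef
  have hζpos : 0 < ζ := by positivity
  have hζ0 : 0 ≤ ζ := hζpos.le
  have hζd : (d : ℝ) < ζ := by rw [hζdef]; linarith
  set K₁ : ℝ := ∑' x : Site d, jnorm x ^ (-ζ) with hK₁def
  have hK₁sum : Summable fun x : Site d => jnorm x ^ (-ζ) := summable_jnorm_rpow_neg hζd
  have hK₁1 : 1 ≤ K₁ := one_le_tsum_jnorm_rpow_neg hζd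
  have h2pos : (0 : ℝ) < 2 ^ (ζ + 1) := by positivity
  have h2one : (1 : ℝ) ≤ 2 ^ (ζ + 1) := Real.one_le_rpow (by norm_num) (by linarith)
  set K : ℝ := 2 ^ (ζ + 1) * (1 + K₁) with hKdef
  have hK1 : 1 ≤ K := by rw [hKdef]; nlinarith
  have hKpos : 0 < K := by linarith
  refine ⟨1 / (2 * K), by positivity, 4 * K, ?_⟩
  intro L z β₀ β₁ h hβ₀ hβ₁ hβ hsym hdecay
  set β := max β₀ β₁ with hβdef
  have hβ₀β : β₀ ≤ β := le_max_left _ _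
  have hβ₁β : β₁ ≤ β := le_max_right _ _
  have hβ0 : 0 ≤ β := hβ₀.trans hβ₀β
  have hβK : β * K ≤ 1 / 2 := by
    calc β * K ≤ 1 / (2 * K) * K := mul_le_mul_of_nonneg_right hβ hKpos.le
      _ = 1 / 2 := by field_simp
  -- `f = δ - h` and its norms
  set f : Site d → ℝ := fun x => delta0 x - h x with hfdef
  have hfdecay : ∀ x, |f x| ≤ β₀ * delta0 x + β₁ / jnorm x ^ ζ := fun x => by
    rw [hfdef, abs_sub_comm]
    exact hdecay x
  have hfs : IsZdSymmetric f := fun π ε x => by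
    show delta0 (Site.signedPerm π ε x) - h (Site.signedPerm π ε x) = delta0 x - h x
    rw [isZdSymmetric_delta0 π ε x, hsym π ε x]
  have hfsum : Summable fun x => |f x| := summable_abs_of_lsBound hβ₀ hfdecay hζd
  have hf1 : ∑' x, |f x| ≤ β * (1 + K₁) := by
    calc ∑' x, |f x| ≤ β₀ + β₁ * K₁ := tsum_abs_le_of_lsBound hβ₀ hfdecay hζd
      _ ≤ β + β * K₁ := add_le_add hβ₀β (mul_le_mul_of_nonneg_right hβ₁β (by linarith))
      _ = β * (1 + K₁) := by ring
  have hfA : 2 ^ (ζ + 1) * ∑' x, |f x| ≤ β * K := by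
    calc 2 ^ (ζ + 1) * ∑' x, |f x| ≤ 2 ^ (ζ + 1) * (β * (1 + K₁)) :=
          mul_le_mul_of_nonneg_left hf1 h2pos.le
      _ = β * K := by rw [hKdef]; ring
  -- the weighted sup: `|x|^ζ |f(x)| ≤ β₁`
  have hsup : ∀ {P : Site d → ℝ} {b : ℝ}, 0 ≤ b → (∀ x, x ≠ 0 → |P x| ≤ b / jnorm x ^ ζ) →
      ∀ x, euclidNorm x ^ ζ * |P x| ≤ b := by
    intro P b hb hP x
    by_cases hx : x = 0
    · subst hx
      rw [euclidNorm_zero', Real.zero_rpow hζpos.ne', zero_mul]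
      exact hb
    · have hj : jnorm x = euclidNorm x := jnorm_of_ne_zero hx
      have hpos : 0 < euclidNorm x ^ ζ := by
        rw [← hj]; exact Real.rpow_pos_of_pos (jnorm_pos x) ζ
      calc euclidNorm x ^ ζ * |P x| ≤ euclidNorm x ^ ζ * (b / jnorm x ^ ζ) :=
            mul_le_mul_of_nonneg_left (hP x hx) hpos.le
        _ = b := by rw [hj]; field_simp
  have hfoff : ∀ x, x ≠ 0 → |f x| ≤ β₁ / jnorm x ^ ζ := fun x hx => by
    have := hfdecay x
    rwa [delta0_of_ne_zero hx, mul_zero, zero_add] at this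
  have hfB : ∀ x, euclidNorm x ^ ζ * |f x| ≤ β * K := fun x =>
    (hsup hβ₁ hfoff x).trans (hβ₁β.trans (le_mul_of_one_le_right hβ0 hK1))
  -- `g_1 = f - f(0)δ` and its norms (`O(β₁)`)
  have hg₁pt : ∀ x, |f x - f 0 * delta0 x| ≤ 0 * delta0 x + β₁ / jnorm x ^ ζ := fun x => by
    rw [zero_mul, zero_add]
    by_cases hx : x = 0
    · subst hx
      rw [delta0_zero, mul_one, sub_self, abs_zero]
      exact div_nonneg hβ₁ (Real.rpow_nonneg (jnorm_pos _).le _)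
    · rw [delta0_of_ne_zero hx, mul_zero, sub_zero]
      exact hfoff x hx
  have hg₁off : ∀ x, x ≠ 0 → |f x - f 0 * delta0 x| ≤ β₁ / jnorm x ^ ζ := fun x _ => by
    have := hg₁pt x; rwa [zero_mul, zero_add] at this
  have hg₁A : 2 ^ (ζ + 1) * ∑' x, |f x - f 0 * delta0 x| ≤ β₁ * K := by
    calc 2 ^ (ζ + 1) * ∑' x, |f x - f 0 * delta0 x| ≤ 2 ^ (ζ + 1) * (0 + β₁ * K₁) :=
          mul_le_mul_of_nonneg_left (tsum_abs_le_of_lsBound le_rfl hg₁pt hζd) h2pos.le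
      _ ≤ 2 ^ (ζ + 1) * (β₁ * (1 + K₁)) := by
          refine mul_le_mul_of_nonneg_left ?_ h2pos.le; nlinarith
      _ = β₁ * K := by rw [hKdef]; ring
  have hg₁B : ∀ x, euclidNorm x ^ ζ * |f x - f 0 * delta0 x| ≤ β₁ * K := fun x =>
    (hsup hβ₁ hg₁off x).trans (le_mul_of_one_le_right hβ₁ hK1)
  -- smallness
  have hMlt : β * K < 1 := by linarith
  have hρ : ∑' x, |f x| ≤ β * K :=
    (le_mul_of_one_le_left (tsum_nonneg fun _ => abs_nonneg _) h2one).trans hfA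
  have hlt : ∑' x, |f x| < 1 := lt_of_le_of_lt hρ hMlt
  have hρhalf : ∑' x, |f x| ≤ 1 / 2 := hρ.trans hβK
  -- `h⁻¹ = Σ_n f^{*n}` and `Φ = δ - h⁻¹ = -Σ_n f^{*(n+1)}`
  set inv : Site d → ℝ := fun x => ∑' n, convPow f n x with hinvdef
  have hΦ : ∀ x, delta0 x - inv x = -∑' n, convPow f (n + 1) x := fun x => by
    show delta0 x - ∑' n, convPow f n x = -∑' n, convPow f (n + 1) x
    rw [tsum_convPow_eq_delta0_add hfsum hlt x]
    ring
  have hinvs : IsZdSymmetric inv := isZdSymmetric_tsum_convPow hfs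
  refine ⟨fun x => delta0 x - inv x, ?_, ?_, ?_⟩
  · -- `ℤ^d`-symmetry of `Φ`
    intro π ε x
    show delta0 (Site.signedPerm π ε x) - inv (Site.signedPerm π ε x) = delta0 x - inv x
    rw [isZdSymmetric_delta0 π ε x, hinvs π ε x]
  · -- the decay of `Φ`
    intro x
    show |delta0 x - inv x| ≤ 4 * K * β * delta0 x + 4 * K * β₁ / jnorm x ^ ζ
    rw [hΦ x, abs_neg]
    have hC0 : 0 ≤ 4 * K * β₁ / jnorm x ^ ζ :=
      div_nonneg (by positivity) (Real.rpow_nonneg (jnorm_pos x).le _)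
    have hβK0 : 0 ≤ β * K := by positivity
    by_cases hx : x = 0
    · subst hx
      rw [delta0_zero, mul_one]
      have h1 : |∑' n, convPow f (n + 1) (0 : Site d)| ≤ 2 * (β * K) := by
        refine (abs_tsum_convPow_succ_le hfsum hlt 0).trans ?_
        rw [div_le_iff₀ (by linarith)]
        nlinarith [(tsum_nonneg fun x => abs_nonneg (f x) : (0 : ℝ) ≤ ∑' x, |f x|)]
      linarith
    · rw [delta0_of_ne_zero hx, mul_zero, zero_add]
      have hj : jnorm x = euclidNorm x := jnorm_of_ne_zero hx
      have hpos : 0 < euclidNorm x ^ ζ := by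
        rw [← hj]; exact Real.rpow_pos_of_pos (jnorm_pos x) ζ
      have hw := rpow_mul_abs_tsum_convPow_succ_le hζ0 hfsum hfA hfB hMlt hg₁A hg₁B hx
      -- `M₁/(1-M)² ≤ 4 M₁` for `M ≤ 1/2`
      have h4 : β₁ * K / (1 - β * K) ^ 2 ≤ 4 * K * β₁ := by
        rw [div_le_iff₀ (by nlinarith)]
        have hq : (1 : ℝ) / 4 ≤ (1 - β * K) ^ 2 := by nlinarith
        have hβ₁K : 0 ≤ β₁ * K := by positivity
        nlinarith
      rw [hj, le_div_iff₀ hpos]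
      calc |∑' n, convPow f (n + 1) x| * euclidNorm x ^ ζ
          = euclidNorm x ^ ζ * |∑' n, convPow f (n + 1) x| := mul_comm _ _
        _ ≤ β₁ * K / (1 - β * K) ^ 2 := hw
        _ ≤ 4 * K * β₁ := h4
  · -- the identity `F * H = δ` for bounded solutions of (4.1)
    rintro H ⟨M, hHM⟩ hH x
    have hhfun : h = fun y => delta0 y - f y := funext fun y => by simp [hfdef]
    have hhsum : Summable fun y => |h y| := by
      rw [hhfun]
      refine Summable.of_nonneg_of_le (fun _ => abs_nonneg _) (fun y => abs_sub _ _)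
        (summable_abs_delta0.add hfsum)
    have hinvsum : Summable fun y => |inv y| := summable_abs_tsum_convPow hfsum hlt
    -- `h⁻¹ * h = δ`
    have hah : ∀ y, latticeConv inv h y = delta0 y := fun y => by
      rw [latticeConv_comm, hhfun]
      exact latticeConv_delta0_sub_neumann hfsum hlt y
    -- `F = δ - zD - Φ = h⁻¹ - zD`
    have hF : lsF d L z (fun y => delta0 y - inv y) = fun y => inv y - z * soStep d L y := by
      funext y; rw [lsF_apply]; ring
    rw [hF]
    exact latticeConv_inv_sub_smul_eq_delta0 hinvsum hhsum summable_abs_soStep hHM hah hH x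

end Prop41

end Literature.Barriers.CriticalPhenomena.SpreadOutIsing

end
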